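import Literature.Analysis.FluidPDE.FluidComputerGadgetOneShot
import Literature.Analysis.FluidPDE.FluidComputerGadgetRobust
import Summits.NavierStokesRegularity.Statement
import HarnessLib

/-!
# Fluid computer, door N1-FC — the ROBUST gadget interface forces STABLE failure for ALL data of the ball; its kicked run is EMPTY

HONEST FRAMING: low prior, high value-of-information experiment on Tao's machine paradigm;
NOT a claim that NS blows up.

(Cell `ns-blowup`, seat `ns-blowup-fc-prover-2`, door N1-FC «forced fluid computer»: support for the
route's typing decision. WHAT THIS IS NOT: not Navier–Stokes evidence — kernel-checked statements about
a TYPED INTERFACE (`Literature.Analysis.FluidPDE.FluidComputer.RobustGadgetLibrary`,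
[cite: Tao2016AveragedNS, §1.3] typed with a stated norm) that nobody has instantiated.)

`FluidComputerGadgetRobust.lean` proves `RobustGadgetLibrary.stable_blowup`: for valid, closing,
super-threshold specs every CLAY-CLASS datum of the relative-`L²` ball `∫ ‖u₀ - seed‖² ≤ rho² E0` has no
global regular solution, and offers `KickedRun.speed_unbounded` as the interface's "machine content"
(the cascade computes through noise injected between every pair of gates). This file records:

* `invariant_from` / `noGlobalRegularSolution_of_mem_inputClass` — the cascade argument of the tree's
  `GadgetLibrary.no_global_regular_solution` runs from ANY datum of the level-`0` input class with
  positive level energy; the seed's Clay-class fields are never used.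
* `noGlobalRegularSolution_near_seed` — hence the robust interface forces failure of global regularity
  for EVERY field of the ball, smooth or not, decaying or not (the tree's `stable_blowup` without its
  three Clay hypotheses).
* `isEmpty_kickedRun` / `isEmpty_kickedRun_of_strictClosure` — consequently, under EXACTLY the
  hypotheses of `RobustGadgetLibrary.KickedRun.speed_unbounded` (valid specs, strict closure with slack
  `gap`, kicked threshold `s⁻¹ < theta * eta`), the type `lib.KickedRun` is EMPTY: stage `0` of a kicked
  run would be a global regular solution from a datum of the ball. The noise-injected cascade never runs;
  the content theorem quantifies over nothing. The repair is the one `FluidComputerGadgetOneShot.lean`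
  names — a step hypothesis over LOCAL solutions on `[t, t + T n]` — i.e. the local, existential step
  semantics of the N1-FC route vocabulary (`TriggerScheme.Step`); this file is the kernel-checked reason
  for that design decision.
* `clayA_fails_on_ball` — read at the summit: `¬ NavierStokesRegularity`, with the failure located on a
  whole `L²`-ball. The companion file `GadgetRobustOneShot.lean` proves the converse calibration (a
  robust library with ANY prescribed tolerances exists iff such a ball exists).

0 sorry; axioms ⊆ {propext, Classical.choice, Quot.sound}; no def, no named fact, no instance asserted.
-/

noncomputable section

open scoped ContDiff ENNReal Topology
open Filter Set Metric MeasureTheory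

namespace Summit.NavierStokesRegularity.FluidComputer.GadgetRobustStableFailure

open Literature.Analysis.FluidPDE Literature.Analysis.FluidPDE.FluidComputer

/-! ## The cascade from an arbitrary datum of the level-`0` input class -/

section GadgetLibrary

variable {ν : ℝ} {σ : GadgetSpec} (lib : GadgetLibrary ν σ)

/-- THE CASCADE INVARIANT FROM AN ARBITRARY DATUM: along any global regular solution from a datum `u₀`
of the level-`0` input class carrying level-`0` energy `≥ E`, at the `n`-th checkpoint the solution is
in the level-`n` input class with level-`n` energy `≥ E * eta ^ n` (the tree's `GadgetLibrary.invariant`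
is the case `u₀ = seed`, `E = E0`; the seed's Clay-class fields are not used). [folklore] -/
theorem invariant_from (hσ : σ.Valid) (hclos : σ.Closure) {u₀ : Vel} {E : ℝ}
    (h₀ : lib.noise 0 u₀ ≤ σ.radius) (hE₀ : E ≤ lib.levelEnergy 0 u₀)
    {u : ℝ → Vel} {p : ℝ → E3 → ℝ} (hu : IsSmoothOnHalfSpace u) (hp : IsSmoothOnHalfSpace p)
    (hsol : IsNavierStokesSolution ν 0 u₀ u p) (hE : HasBoundedEnergy u) (n : ℕ) :
    lib.noise n (u (lib.checkpoint n)) ≤ σ.radius ∧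
      E * σ.eta ^ n ≤ lib.levelEnergy n (u (lib.checkpoint n)) := by
  induction n with
  | zero =>
    rw [lib.checkpoint_zero, hsol.initial]
    exact ⟨h₀, by simpa using hE₀⟩
  | succ n ih =>
    obtain ⟨hx, hEn⟩ := ih
    obtain ⟨hnoise, henergy⟩ :=
      lib.step u₀ u p hu hp hsol hE n (lib.checkpoint n) (lib.checkpoint_nonneg n) hx
    rw [lib.checkpoint_succ]
    refine ⟨?_, ?_⟩
    · have h1 : σ.eta * lib.noise (n + 1) (u (lib.checkpoint n + lib.T n)) ≤ σ.eta * σ.radius :=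
        calc σ.eta * lib.noise (n + 1) (u (lib.checkpoint n + lib.T n))
            ≤ σ.amp * lib.noise n (u (lib.checkpoint n)) + σ.leak + σ.dStar := hnoise
          _ ≤ σ.amp * σ.radius + σ.leak + σ.dStar := by
              have := mul_le_mul_of_nonneg_left hx hσ.amp_nonneg
              linarith
          _ ≤ σ.eta * σ.radius := hclos.le
      exact le_of_mul_le_mul_left h1 hσ.eta_pos
    · calc E * σ.eta ^ (n + 1) = σ.eta * (E * σ.eta ^ n) := by ring
        _ ≤ σ.eta * lib.levelEnergy n (u (lib.checkpoint n)) :=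
            mul_le_mul_of_nonneg_left hEn hσ.eta_pos.le
        _ ≤ lib.levelEnergy (n + 1) (u (lib.checkpoint n + lib.T n)) := henergy

/-- NO GLOBAL REGULAR SOLUTION FROM ANY DATUM OF THE LEVEL-`0` INPUT CLASS with positive level-`0`
energy, for a library with valid, closing specs above the efficiency threshold `s⁻¹ < eta`: the proof
of the tree's `GadgetLibrary.no_global_regular_solution`, run from `u₀` instead of the seed
(`invariant_from`, the concentration floor, `(s³ eta)ⁿ → ∞` against boundedness of a smooth field on
the compact cylinder `[0, horizon] × B̄(0, R)`). HONEST FRAMING: an implication from an interface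
nobody has instantiated; NOT a claim that NS blows up. [folklore] -/
theorem noGlobalRegularSolution_of_mem_inputClass (hσ : σ.Valid) (hclos : σ.Closure)
    (hvisc : σ.s⁻¹ < σ.eta) {u₀ : Vel} (h₀ : lib.noise 0 u₀ ≤ σ.radius) {E : ℝ} (hEpos : 0 < E)
    (hE₀ : E ≤ lib.levelEnergy 0 u₀) : NoGlobalRegularSolution ν u₀ := by
  rintro ⟨u, p, hu, hp, hsol, hE⟩
  -- smoothness on the closed half-space gives a uniform bound on the compact cylinder
  have hu' : ContDiffOn ℝ ∞ (Function.uncurry u) (Set.Ici (0 : ℝ) ×ˢ Set.univ) := hu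
  obtain ⟨C, hC⟩ :=
    (isCompact_Icc.prod (isCompact_closedBall (0 : E3) lib.R)).exists_bound_of_continuousOn
      (hu'.continuousOn.mono (Set.prod_mono Set.Icc_subset_Ici_self (Set.subset_univ _)))
  -- along the cascade the squared speed floor is therefore bounded by `(max C 1)²`
  have bound : ∀ n, lib.cFloor * σ.k n ^ 3 * (E * σ.eta ^ n) ≤ max C 1 ^ 2 := by
    intro n
    obtain ⟨hx, hEn⟩ := invariant_from lib hσ hclos h₀ hE₀ hu hp hsol hE n
    obtain ⟨x, hxR, hfloor⟩ := lib.floor n (u (lib.checkpoint n)) hx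
    have hmem : (lib.checkpoint n, x) ∈
        Set.Icc (0 : ℝ) σ.horizon ×ˢ Metric.closedBall (0 : E3) lib.R :=
      ⟨⟨lib.checkpoint_nonneg n, lib.checkpoint_le_horizon hσ n⟩, mem_closedBall_zero_iff.2 hxR⟩
    have hux : ‖u (lib.checkpoint n) x‖ ≤ max C 1 := (hC _ hmem).trans (le_max_left _ _)
    have hk3 : 0 ≤ lib.cFloor * σ.k n ^ 3 :=
      mul_nonneg lib.cFloor_pos.le (pow_nonneg (GadgetSpec.k_pos hσ n).le 3)
    calc lib.cFloor * σ.k n ^ 3 * (E * σ.eta ^ n)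
        ≤ lib.cFloor * σ.k n ^ 3 * lib.levelEnergy n (u (lib.checkpoint n)) :=
          mul_le_mul_of_nonneg_left hEn hk3
      _ ≤ ‖u (lib.checkpoint n) x‖ ^ 2 := hfloor
      _ ≤ max C 1 ^ 2 := pow_le_pow_left₀ (norm_nonneg _) hux 2
  -- but that floor is `cFloor * k0³ * E * (s³ * eta) ^ n → ∞`
  have hq : 1 < σ.s ^ 3 * σ.eta := GadgetSpec.one_lt_cube_mul_eta hσ.one_lt_s hσ.eta_pos hvisc
  have hA : 0 < lib.cFloor * σ.k0 ^ 3 * E :=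
    mul_pos (mul_pos lib.cFloor_pos (pow_pos hσ.k0_pos 3)) hEpos
  have htend : Tendsto (fun n : ℕ => lib.cFloor * σ.k0 ^ 3 * E * (σ.s ^ 3 * σ.eta) ^ n)
      atTop atTop :=
    (tendsto_pow_atTop_atTop_of_one_lt hq).const_mul_atTop hA
  obtain ⟨n, hn⟩ := (htend.eventually_gt_atTop (max C 1 ^ 2)).exists
  have heq : lib.cFloor * σ.k0 ^ 3 * E * (σ.s ^ 3 * σ.eta) ^ n =
      lib.cFloor * σ.k n ^ 3 * (E * σ.eta ^ n) := by
    unfold GadgetSpec.k; ring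
  have hn' : max C 1 ^ 2 < lib.cFloor * σ.k n ^ 3 * (E * σ.eta ^ n) := by
    rw [← heq]; exact hn
  exact absurd (bound n) (not_le.2 hn')

end GadgetLibrary

/-! ## The robust interface: stable blow-up for ALL data in the ball, and the empty kicked run -/

section RobustGadgetLibrary

variable {ν : ℝ} {σ : GadgetSpec} (lib : RobustGadgetLibrary ν σ)

/-- **STABLE BLOW-UP FOR EVERY DATUM IN THE BALL.** For a robust gadget library with valid, closing
specs above the threshold `s⁻¹ < eta`, NO field `u₀` with `∫ ‖u₀ - seed‖² ≤ rho² · E0` — smooth or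
not, decaying or not — has a global smooth bounded-energy Navier–Stokes solution: the robustness axiom
puts `u₀` in the level-`0` input class with energy `≥ theta · E0`, and the cascade runs from there
(`noGlobalRegularSolution_of_mem_inputClass`). Strengthens the tree's
`RobustGadgetLibrary.stable_blowup` (Clay-class `u₀`). HONEST FRAMING: an implication from an
interface nobody has instantiated; NOT a claim that NS blows up. [folklore] -/
theorem noGlobalRegularSolution_near_seed (hσ : σ.Valid) (hclos : σ.Closure) (hvisc : σ.s⁻¹ < σ.eta)
    {u₀ : Vel} (h : l2DistSq u₀ lib.seed ≤ ENNReal.ofReal (lib.rho ^ 2 * lib.E0)) :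
    NoGlobalRegularSolution ν u₀ :=
  noGlobalRegularSolution_of_mem_inputClass lib.toGadgetLibrary hσ hclos hvisc
    (lib.noise_le_of_near_seed h) (mul_pos lib.theta_pos lib.E0_pos) (lib.energy_ge_of_near_seed h)

/-- The same ball with its radius written as `rho * √E0`: every field `w` with
`∫ ‖w - seed‖² ≤ (rho √E0)²` has no global regular solution. [folklore] -/
theorem noGlobalRegularSolution_of_l2DistSq_le (hσ : σ.Valid) (hclos : σ.Closure)
    (hvisc : σ.s⁻¹ < σ.eta) {w : Vel}
    (hw : l2DistSq w lib.seed ≤ ENNReal.ofReal ((lib.rho * Real.sqrt lib.E0) ^ 2)) :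
    NoGlobalRegularSolution ν w := by
  rw [mul_pow, Real.sq_sqrt lib.E0_pos.le] at hw
  exact noGlobalRegularSolution_near_seed lib hσ hclos hvisc hw

/-- The radius of that ball is positive. [folklore] -/
theorem rho_mul_sqrt_E0_pos : 0 < lib.rho * Real.sqrt lib.E0 :=
  mul_pos lib.rho_pos (Real.sqrt_pos.2 lib.E0_pos)

/-- **THE KICKED RUN IS EMPTY.** For a robust library with valid, closing specs above the threshold
`s⁻¹ < eta` there is NO kicked run at all: its stage `0` would be a global regular solution from the
kicked seed `w 0`, a datum of the blow-up ball (`noGlobalRegularSolution_near_seed`). [folklore] -/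
theorem isEmpty_kickedRun (hσ : σ.Valid) (hclos : σ.Closure) (hvisc : σ.s⁻¹ < σ.eta) :
    IsEmpty lib.KickedRun :=
  ⟨fun run => noGlobalRegularSolution_near_seed lib hσ hclos hvisc run.kick_zero
    ⟨run.u 0, run.p 0, run.smooth_u 0, run.smooth_p 0, run.sol 0, run.energy 0⟩⟩

/-- **The tree's content theorem `KickedRun.speed_unbounded` is vacuous as typed**: under EXACTLY its
hypotheses (valid specs, strict closure with slack `gap`, kicked threshold `s⁻¹ < theta * eta` — which
give closure and `s⁻¹ < eta` since `theta ≤ 1`) the type `lib.KickedRun` it quantifies over is empty.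
The repair is the one named in `FluidComputerGadgetOneShot.lean`: a step hypothesis over LOCAL
solutions on `[t, t + T n]`, so that a stage need not be a global regular solution. [folklore] -/
theorem isEmpty_kickedRun_of_strictClosure (hσ : σ.Valid) (hclos : σ.StrictClosure lib.gap)
    (hvisc : σ.s⁻¹ < lib.theta * σ.eta) : IsEmpty lib.KickedRun :=
  isEmpty_kickedRun lib hσ (hclos.closure hσ lib.gap_pos.le)
    (hvisc.trans_le (mul_le_of_le_one_left hσ.eta_pos.le lib.theta_le_one))

end RobustGadgetLibrary


/-! ## At the summit -/

/-- **`clayA_fails_on_ball`**: a robust gadget library for a viscosity `ν > 0` with valid, closing,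
super-threshold specs refutes Clay (A) `NavierStokesRegularity`, and locates the failure on the whole
`L²`-ball of squared radius `rho² E0` about its seed: NO datum there (Clay-class or not) has a global
regular solution. (`Theorems.ns_clayA_fails_near_seed` is the Clay-class case.) HONEST FRAMING: an
implication from an interface nobody has instantiated; NOT a claim that NS blows up. [folklore] -/
theorem clayA_fails_on_ball {ν : ℝ} (hν : 0 < ν) {σ : GadgetSpec} (hσ : σ.Valid) (hclos : σ.Closure)
    (hvisc : σ.s⁻¹ < σ.eta) (lib : RobustGadgetLibrary ν σ) :
    (∀ u₀ : Vel, l2DistSq u₀ lib.seed ≤ ENNReal.ofReal (lib.rho ^ 2 * lib.E0) →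
      NoGlobalRegularSolution ν u₀) ∧ ¬ NavierStokesRegularity :=
  ⟨fun _ h => noGlobalRegularSolution_near_seed lib hσ hclos hvisc h, fun hNS =>
    noGlobalRegularSolution_near_seed lib hσ hclos hvisc lib.seed_mem_ball
      (hNS ν hν lib.seed lib.seed_smooth lib.seed_divFree lib.seed_decay)⟩

end Summit.NavierStokesRegularity.FluidComputer.GadgetRobustStableFailure

end
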